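import Summits.QuantumFields.YangMills.Theorems.BalabanUVNodesN11AFibreDominationOnJointSupport

/-!
# DAG node N11 — THE READING LOCUS OF A GENERATION's A-WEIGHT IN 11a's ORDERED PRODUCT (the domination row asked ONLY there; the θ-level coercivity corollary lives in `…N11TwoScaleLocalityReadingLocus`):
# in `𝐓_k(s,S)[Φ](base_k U₀)` generation `j`'s weight `w_j` is evaluated only at configurations whose scales `< j` still sit at the BASE configuration `(1, 0)`
# (they are integrated later, inside), whose scales `> k` sit at the base, whose level-`k` component is `(U₀, 0)` with the step's front factor alive, and whose
# scales `i ∈ [j,k)` carry live certificates `ζ_i((Ω_{i+1})ᶜ) ≠ 0` (at an `A_i`-fibre-mate) — the kernel certificate of this seat's LOCATED-NESTING reading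
# (bus 02:33Z) and the sharpest form of the row node00-def-K0b's VALUE of `Zh.quad` has to meet

HEADER — WORK-UNIT METADATA.  Cell `pub-ymgap`, YM-PLAN Track A (HUMAN RULING D-0062 ∕ D-0149), WIDTH SEAT `pub-ymgap-dag-n11-w4` (g2) on NODE n11 [B14]; route
`BalabanUVNodes` rev 25, item K1⁷ `StabilityBAtRecordR13SepCoPH` = stmt-QuantumFields-20542 (helper, `--kind proof --supports 20542 --as helper`, count-neutral).
Sibling of this seat's `…N11AFibreDominationOnJointSupport` (p598996), whose §1 induction it repeats with ONE more invariant (the inner scales agree with a reference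
configuration).  [III] = [Balaban1988Convergent], [I] = [Balaban1987RG1].

WHY THIS FILE (located, count-neutral).  In 11a's nesting `𝐓_k = 𝐓^{(k−1)} ∘ ⋯ ∘ 𝐓^{(0)}` ((2.20), newest outermost) generation `m` modifies component `m` of the
all-scales configuration only; started at `base_k U₀` (component `k` = `(U₀, 0)`, every other component `(1, 0)`), the configuration at which `w_j` is read therefore
has: components `< j` STILL AT THE BASE (the inner generations have not run), components `> k` at the base, component `k` equal to `(U₀, 0)`, components in
`[j,k)` set by the outer generations (with their certificates alive, p598996).  So a VALUE of `quad_j(Λ_{j+1})` is only ever read on this locus — in particular it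
can depend meaningfully on the retained variables of the scales `≥ j` only ([III] (2.23): `A_k` reads `V` through `U_k(V)`, `V = (V_i on Γ_i)_{i ≤ k}` (2.10); whether
[I]'s localized background for `𝒬_j` needs the shells `Γ_i`, `i < j`, is for node00-def-T ∕ K0b to say) — and [I]'s positivity need only be displayed there.

WHAT THIS FILE PROVES (0 `sorry`, 0 `def`; standard axioms).
§1 ★★ `tkBranchOfRecord_congr_on_reading_locus` — p598996 §1 with the extra invariant «components `< j` agree with a reference configuration `ω₀`».
§2 ★★ `integrable_front_mul_tkBranchOfRecord_baseCfg_of_dominated_on_reading_locus` — C2 §5 with front factor, the domination row asked ONLY on the reading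
   locus: inner scales at the base, outer certificates alive, level-`k` component `(U, 0)` with `f U ≠ 0`, scales `> k` at the base.
§3 REMOVED (R495 flaw-1, W2 2026-08-29): the former θ-level corollary `integrable_front_mul_oldBranch_of_coercive_on_reading_locus` took `hloc : (θ.zhAt p s).LocalLaws` in 12b's ONE-SCALE form, the hypothesis p675059∕p676049 show degenerate; its two-scale edition is `…N11TwoScaleLocalityReadingLocus.integrable_front_mul_oldBranch_of_coercive_on_reading_locus₂` (p692578).

HONEST FRAMING.  Helper lane of K1⁷; kernel∕measure bookkeeping over accepted tree objects; [I]'s positivity of `𝒬_j` stays a DISPLAYED row of the consumers (the θ-level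
corollary on the exact reading locus now lives in `…N11TwoScaleLocalityReadingLocus`, two-scale edition); no law of record is edited or posited; the nesting is def-T's 11a AS TYPED — this file only certifies what it reads.  N11 NOT discharged;
K1⁷ NOT closed; counts unmoved (typed 28∕28 · discharged 5∕27).  One finite four-torus programme at fixed `ε = L^{−K}`; R4 closes only the conditional finite-𝕋⁴
rung `BalabanLadder.UV` — NOT ℝ⁴, NOT OS, NOT a mass gap, NOT Clay.  No `sorry`, `axiom`, `def`, `instance`, `notation`.
Sources (SHAPE only): [III] (2.10) p.256, (2.17)–(2.18) p.257, (2.20)–(2.23) p.258, (3.23)–(3.24) p.270; [I] (2.11) p.267 (shape of the row).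
-/

noncomputable section

open MeasureTheory
open scoped BigOperators ENNReal NNReal

namespace Summit.QuantumFields.YangMills.Theorems.BalabanUVNodesN11TkBranchReadingLocus

open Literature.MathematicalPhysics.QuantumFieldTheory.Balaban1983to89 T4Continuum T4NestedCovariance T4AdjointCovariance Node00 Node00.Tk
open B15DeterminingSets (MSField)
open B10Eq42TorusConstraint (bondsIn)
open BalabanUVNodesN11TkBranchMassBound (integrable_tkBranchOfRecord_baseCfg_of_dominated)
open BalabanUVNodesN11AFibreDominationOnSupport (aOp_congr_of_eq_on_fibre)

/-! ## §1  Generic: two weight data agreeing on the READING LOCUS have the same branch operator at every ambient configuration agreeing with the reference below `k` -/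
section Congr

variable {F : T4Family} {N : ℕ} [NeZero N] {V : Type} [NormedAddCommGroup V] [InnerProductSpace ℝ V] [FiniteDimensional ℝ V]
  [MeasurableSpace V] [BorelSpace V]
variable (ν : Stage7Numerics) (M : ℕ) (g : ℕ → ℝ) (K : ℕ)

/-- **★★ CONGRUENCE OF THE BRANCH OPERATORS ON THE READING LOCUS.**  As p598996's `tkBranchOfRecord_congr_on_joint_support`, with ONE more invariant: the
A-weights need agree only at configurations `ω′` whose components `< j` coincide with those of a REFERENCE configuration `ω₀` (generation `m` modifies component `m`
only, so inside `𝐓_m` the components `< m` are still the caller's); conclusion at every `Amb` configuration agreeing with `ω₀` below `k`.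
[cite: Balaban1988Convergent, (2.20)–(2.21) p.258, (3.24) p.270, (2.10) p.256] -/
theorem tkBranchOfRecord_congr_on_reading_locus (W W' : TkWeights F N V K) {n : ℕ} (s : SeqOfRecord F ν M g K n) (S : ℕ → Set (Site (F.P K) 0))
    (k : ℕ) (ω₀ : MultiCfg (F.P K) (SU N) V) (Amb : MultiCfg (F.P K) (SU N) V → Prop)
    (hAmb : ∀ ω ω' : MultiCfg (F.P K) (SU N) V, (∀ i, k ≤ i → ω' i = ω i) → Amb ω → Amb ω')
    (hζ : ∀ j, j < k → W'.ζ j (s.Ω (j + 1))ᶜ = W.ζ j (s.Ω (j + 1))ᶜ)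
    (hζloc : ∀ j, j < k → ∀ ω ω' : MultiCfg (F.P K) (SU N) V, ω j = ω' j → W.ζ j (s.Ω (j + 1))ᶜ ω = W.ζ j (s.Ω (j + 1))ᶜ ω')
    (hw : ∀ j, j < k → ∀ ω' : MultiCfg (F.P K) (SU N) V, Amb ω' → (∀ i, i < j → ω' i = ω₀ i) →
      (∀ i, j ≤ i → i < k → ∃ c : JCfg (F.P K) i (SU N) V, c.1 = (ω' i).1 ∧
        (∀ b, b ∉ bondsIn i ((s.Λ (i + 1))ᶜ ∩ s.Ω (i + 1)) → c.2 b = (ω' i).2 b) ∧ W.ζ i (s.Ω (i + 1))ᶜ (Function.update ω' i c) ≠ 0) →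
      W'.w j (s.Λ (j + 1)) ((s.Λ (j + 1))ᶜ ∩ s.Ω (j + 1)) (S (j + 1)) ω' = W.w j (s.Λ (j + 1)) ((s.Λ (j + 1))ᶜ ∩ s.Ω (j + 1)) (S (j + 1)) ω')
    (Φ : MultiCfg (F.P K) (SU N) V → ℝ) (ω : MultiCfg (F.P K) (SU N) V) (hω : Amb ω) (hω₀ : ∀ i, i < k → ω i = ω₀ i) :
    tkBranchOfRecord F N V ν M g K W' s S k Φ ω = tkBranchOfRecord F N V ν M g K W s S k Φ ω := by
  -- the induction over the generations, on VALUES, carrying the ambient predicate and the certificates of the generations `≥ m`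
  have key : ∀ m, m ≤ k → ∀ ω : MultiCfg (F.P K) (SU N) V, Amb ω → (∀ i, i < m → ω i = ω₀ i) →
      (∀ i, m ≤ i → i < k → ∃ c : JCfg (F.P K) i (SU N) V, c.1 = (ω i).1 ∧
        (∀ b, b ∉ bondsIn i ((s.Λ (i + 1))ᶜ ∩ s.Ω (i + 1)) → c.2 b = (ω i).2 b) ∧ W.ζ i (s.Ω (i + 1))ᶜ (Function.update ω i c) ≠ 0) →
      tkBranchOfRecord F N V ν M g K W' s S m Φ ω = tkBranchOfRecord F N V ν M g K W s S m Φ ω := by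
    intro m
    induction m with
    | zero => intro _ ω _ _ _; rfl
    | succ m ih =>
        intro hm ω hAω hlow hsupp
        have hmk : m < k := Nat.lt_of_succ_le hm
        -- 11a's generations carry the CLASSICAL `DecidableEq` on bonds
        letI hdec : DecidableEq (PBond (F.P K) m) := fun a b => Classical.propDecidable (a = b)
        rw [tkBranchOfRecord_succ, tkBranchOfRecord_succ]
        simp only [genOp_apply, vOp_apply, zetaOp_apply]
        show kernelRTOfRecord F N K m _ _ _ _ = kernelRTOfRecord F N K m _ _ _ _
        congr 1
        funext y
        -- the configuration after the V-update of generation `m`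
        set ωy : MultiCfg (F.P K) (SU N) V := Function.update ω m
          (Function.updateFinset (ω m).1 (Set.toFinite (bondsIn m (s.Ω (m + 1))ᶜ)).toFinset y, (ω m).2) with hωy
        have hωy_ne : ∀ i, i ≠ m → ωy i = ω i := fun i hi => by rw [hωy, Function.update_of_ne hi]
        show W'.ζ m (s.Ω (m + 1))ᶜ ωy * _ = W.ζ m (s.Ω (m + 1))ᶜ ωy * _
        rw [hζ m hmk]
        by_cases hζ0 : W.ζ m (s.Ω (m + 1))ᶜ ωy = 0
        · rw [hζ0, zero_mul, zero_mul]
        · congr 1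
          rw [aOp_apply, aOp_apply]
          refine congrArg (fun φ : (↥(Set.toFinite (bondsIn m ((s.Λ (m + 1))ᶜ ∩ s.Ω (m + 1)))).toFinset → V) → ℝ =>
            ∫ a, φ a ∂(Measure.pi fun _ => (volume : Measure V))) (funext fun a => ?_)
          -- the configuration after the A-update: on the `A_m`-fibre of `ωy`, components `≠ m` untouched
          set ωa : MultiCfg (F.P K) (SU N) V := Function.update ωy m
            (insA (Set.toFinite (bondsIn m ((s.Λ (m + 1))ᶜ ∩ s.Ω (m + 1)))).toFinset a (ωy m)) with hωa
          have hωa_ne : ∀ i, i ≠ m → ωa i = ω i := fun i hi => by rw [hωa, Function.update_of_ne hi, hωy_ne i hi]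
          have hωa_m1 : (ωa m).1 = (ωy m).1 := by rw [hωa, Function.update_self]; rfl
          have hωa_m2 : ∀ b, b ∉ bondsIn m ((s.Λ (m + 1))ᶜ ∩ s.Ω (m + 1)) → (ωy m).2 b = (ωa m).2 b := fun b hb => by
            have h' : (ωa m).2 b = (ωy m).2 b := by
              rw [hωa, Function.update_self]
              show Function.updateFinset (ωy m).2 _ a b = (ωy m).2 b
              rw [Function.updateFinset_def]
              exact dif_neg fun h => hb ((Set.Finite.mem_toFinset _).mp h)
            exact h'.symm
          have hωa_back : Function.update ωa m (ωy m) = ωy := by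
            rw [hωa, Function.update_idem, Function.update_eq_self]
          have hAa : Amb ωa := hAmb ω ωa (fun i hi => hωa_ne i (Nat.ne_of_lt (lt_of_lt_of_le hmk hi)).symm) hAω
          have hlowa : ∀ i, i < m → ωa i = ω₀ i := fun i hi => by rw [hωa_ne i (Nat.ne_of_lt hi)]; exact hlow i (Nat.lt_succ_of_lt hi)
          -- the joint support at `ωa` for every `i ∈ [m, k)`
          have hsuppa : ∀ i, m ≤ i → i < k → ∃ c : JCfg (F.P K) i (SU N) V, c.1 = (ωa i).1 ∧
              (∀ b, b ∉ bondsIn i ((s.Λ (i + 1))ᶜ ∩ s.Ω (i + 1)) → c.2 b = (ωa i).2 b) ∧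
              W.ζ i (s.Ω (i + 1))ᶜ (Function.update ωa i c) ≠ 0 := by
            intro i hmi hik
            by_cases him : i = m
            · subst him
              refine ⟨ωy i, hωa_m1.symm, hωa_m2, ?_⟩
              rw [hωa_back]
              exact hζ0
            · obtain ⟨c, hc1, hc2, hcζ⟩ := hsupp i (by omega) hik
              refine ⟨c, by rw [hωa_ne i him]; exact hc1, fun b hb => by rw [hωa_ne i him]; exact hc2 b hb, ?_⟩
              rw [hζloc i hik (Function.update ωa i c) (Function.update ω i c) (by rw [Function.update_self, Function.update_self])]
              exact hcζ
          show W'.w m (s.Λ (m + 1)) ((s.Λ (m + 1))ᶜ ∩ s.Ω (m + 1)) (S (m + 1)) ωa * tkBranchOfRecord F N V ν M g K W' s S m Φ ωa =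
            W.w m (s.Λ (m + 1)) ((s.Λ (m + 1))ᶜ ∩ s.Ω (m + 1)) (S (m + 1)) ωa * tkBranchOfRecord F N V ν M g K W s S m Φ ωa
          rw [hw m hmk ωa hAa hlowa hsuppa, ih hmk.le ωa hAa hlowa hsuppa]
  exact key k le_rfl ω hω hω₀ (fun i hi hik => absurd hik (not_lt.mpr hi))

end Congr

/-! ## §2  ★★ Generic C2 level: `front · 𝐓_k(s,S)[Φ](base_k ·)` is integrable under A-fibre domination ON THE READING LOCUS -/
section ReadingLocus

variable {F : T4Family} {N : ℕ} [NeZero N] {V : Type} [NormedAddCommGroup V] [InnerProductSpace ℝ V] [FiniteDimensional ℝ V]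
  [MeasurableSpace V] [BorelSpace V]
variable (ν : Stage7Numerics) (M : ℕ) (g : ℕ → ℝ) (K : ℕ) (W : TkWeights F N V K)

/-- **★★ `U₀ ↦ f(U₀)·𝐓_k(s,S)[Φ](base_k U₀)` IS INTEGRABLE UNDER A-FIBRE DOMINATION ON THE READING LOCUS** — dag-n11-d's C2 §5 with a bounded measurable front
factor `f` and its domination row asked, for `j < k`, ONLY at configurations `ω′` with: (L1) the scales `i < j` at the base, `ω′ i = (1, 0)`; (L2) the scales `i > k` at
the base and the level-`k` fluctuation variables zero, with `f((ω′ k).1) ≠ 0`; (L3) for every `i ∈ [j,k)` an `A_i`-fibre-mate with `ζ_i((Ω_{i+1})ᶜ) ≠ 0`.  Requires the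
locality of `ζ_i` (`i < k`).  (Guarded weights; §1 with reference `base_k U₀` and the ambient predicate «components `≥ k` are those of `base_k U` for some `U` with
`f U ≠ 0`»; C2 §5; `Integrable.mul_bdd`.) [cite: Balaban1988Convergent, (2.18) p.257, (2.20)–(2.21) p.258, (3.23)–(3.24) p.270, (2.10) p.256] -/
theorem integrable_front_mul_tkBranchOfRecord_baseCfg_of_dominated_on_reading_locus {n : ℕ} (s : SeqOfRecord F ν M g K n)
    (S : ℕ → Set (Site (F.P K) 0)) (k : ℕ)
    (hζm : ∀ j, Measurable (W.ζ j (s.Ω (j + 1))ᶜ)) (hζ0 : ∀ j ω, 0 ≤ W.ζ j (s.Ω (j + 1))ᶜ ω) (hζ1 : ∀ j ω, W.ζ j (s.Ω (j + 1))ᶜ ω ≤ 1)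
    (hζloc : ∀ j, j < k → ∀ ω ω' : MultiCfg (F.P K) (SU N) V, ω j = ω' j → W.ζ j (s.Ω (j + 1))ᶜ ω = W.ζ j (s.Ω (j + 1))ᶜ ω')
    (hwm : ∀ j, Measurable (W.w j (s.Λ (j + 1)) ((s.Λ (j + 1))ᶜ ∩ s.Ω (j + 1)) (S (j + 1))))
    (hw0 : ∀ j ω, 0 ≤ W.w j (s.Λ (j + 1)) ((s.Λ (j + 1))ᶜ ∩ s.Ω (j + 1)) (S (j + 1)) ω)
    (ŵ : (j : ℕ) → (↥(Set.toFinite (bondsIn j ((s.Λ (j + 1))ᶜ ∩ s.Ω (j + 1)))).toFinset → V) → ℝ≥0∞) (hŵm : ∀ j, Measurable (ŵ j))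
    (f : GaugeField (F.P K) k (SU N) → ℝ) (hfm : Measurable f) (Cf : ℝ) (hfb : ∀ U, |f U| ≤ Cf)
    (hdom : ∀ j, j < k → ∀ ω' : MultiCfg (F.P K) (SU N) V,
      -- (L1) the inner scales still at the base configuration
      (∀ i, i < j → ω' i = ((fun _ => 1), (fun _ => 0))) →
      -- (L2) the scales `≥ k` as at the base configuration of SOME `U` with the front factor alive
      (∃ U : GaugeField (F.P K) k (SU N), f U ≠ 0 ∧ ∀ i, k ≤ i → ω' i = baseCfg (V := V) k U i) →
      -- (L3) the outer certificates alive
      (∀ i, j ≤ i → i < k → ∃ c : JCfg (F.P K) i (SU N) V, c.1 = (ω' i).1 ∧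
        (∀ b, b ∉ bondsIn i ((s.Λ (i + 1))ᶜ ∩ s.Ω (i + 1)) → c.2 b = (ω' i).2 b) ∧ W.ζ i (s.Ω (i + 1))ᶜ (Function.update ω' i c) ≠ 0) →
      ENNReal.ofReal (W.w j (s.Λ (j + 1)) ((s.Λ (j + 1))ᶜ ∩ s.Ω (j + 1)) (S (j + 1)) ω') ≤
        ŵ j (fun b : ↥(Set.toFinite (bondsIn j ((s.Λ (j + 1))ᶜ ∩ s.Ω (j + 1)))).toFinset => (ω' j).2 b))
    (Cw : ℕ → ℝ≥0) (hCw : ∀ j, ∫⁻ a, ŵ j a ∂(Measure.pi fun _ : ↥(Set.toFinite (bondsIn j ((s.Λ (j + 1))ᶜ ∩ s.Ω (j + 1)))).toFinset => (volume : Measure V)) ≤ Cw j)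
    {Φ : MultiCfg (F.P K) (SU N) V → ℝ} (hΦm : Measurable Φ) (hΦ0 : ∀ ω, 0 ≤ Φ ω) (CΦ : ℝ) (hΦle : ∀ ω, Φ ω ≤ CΦ) :
    Integrable (fun U₀ : GaugeField (F.P K) k (SU N) => f U₀ * tkBranchOfRecord F N V ν M g K W s S k Φ (baseCfg k U₀))
      (fieldMeasure (F.P K) k (SU N)) := by
  -- the guard sets and the guarded weights (as in `…N11AFibreDominationOnSupport` §2)
  let Gd : ℕ → Set (MultiCfg (F.P K) (SU N) V) := fun j =>
    {ω | ENNReal.ofReal (W.w j (s.Λ (j + 1)) ((s.Λ (j + 1))ᶜ ∩ s.Ω (j + 1)) (S (j + 1)) ω) ≤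
      ŵ j (fun b : ↥(Set.toFinite (bondsIn j ((s.Λ (j + 1))ᶜ ∩ s.Ω (j + 1)))).toFinset => (ω j).2 b)}
  have hproj : ∀ j, Measurable (fun ω : MultiCfg (F.P K) (SU N) V =>
      (fun b : ↥(Set.toFinite (bondsIn j ((s.Λ (j + 1))ᶜ ∩ s.Ω (j + 1)))).toFinset => (ω j).2 b)) := fun j =>
    measurable_pi_lambda _ fun b => (measurable_pi_apply (b : PBond (F.P K) j)).comp (measurable_snd.comp (measurable_pi_apply j))
  have hGd : ∀ j, MeasurableSet (Gd j) := fun j => measurableSet_le (hwm j).ennreal_ofReal ((hŵm j).comp (hproj j))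
  let W' : TkWeights F N V K := ⟨W.ζ, W.quad, fun j Y S' => (Gd j).indicator (W.chiA j Y S')⟩
  have hw' : ∀ (j : ℕ) (Λ' Y S' : Set (Site (F.P K) 0)), W'.w j Λ' Y S' = (Gd j).indicator (W.w j Λ' Y S') := by
    intro j Λ' Y S'
    funext ω
    show (Gd j).indicator (W.chiA j Y S') ω * Real.exp (-(1 / 2 : ℝ) * W.quad j Λ' ω) =
      (Gd j).indicator (fun ω => W.chiA j Y S' ω * Real.exp (-(1 / 2 : ℝ) * W.quad j Λ' ω)) ω
    exact (Set.indicator_mul_left (Gd j) (W.chiA j Y S') (fun ω => Real.exp (-(1 / 2 : ℝ) * W.quad j Λ' ω))).symm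
  have hwm' : ∀ j, Measurable (W'.w j (s.Λ (j + 1)) ((s.Λ (j + 1))ᶜ ∩ s.Ω (j + 1)) (S (j + 1))) := fun j => by
    rw [hw']
    exact (hwm j).indicator (hGd j)
  have hw0' : ∀ j ω, 0 ≤ W'.w j (s.Λ (j + 1)) ((s.Λ (j + 1))ᶜ ∩ s.Ω (j + 1)) (S (j + 1)) ω := fun j ω => by
    rw [hw']
    exact Set.indicator_nonneg (fun ω _ => hw0 j ω) ω
  have hdom' : ∀ j ω, ENNReal.ofReal (W'.w j (s.Λ (j + 1)) ((s.Λ (j + 1))ᶜ ∩ s.Ω (j + 1)) (S (j + 1)) ω) ≤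
      ŵ j (fun b : ↥(Set.toFinite (bondsIn j ((s.Λ (j + 1))ᶜ ∩ s.Ω (j + 1)))).toFinset => (ω j).2 b) := fun j ω => by
    rw [hw']
    by_cases hω : ω ∈ Gd j
    · rw [Set.indicator_of_mem hω]
      exact hω
    · rw [Set.indicator_of_notMem hω, ENNReal.ofReal_zero]
      exact bot_le
  -- C2 §5 at the guarded weights, times the bounded front factor
  have hB : Integrable (fun U₀ : GaugeField (F.P K) k (SU N) => tkBranchOfRecord F N V ν M g K W' s S k Φ (baseCfg k U₀))
      (fieldMeasure (F.P K) k (SU N)) :=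
    integrable_tkBranchOfRecord_baseCfg_of_dominated ν M g K W' s S hζm hζ0 hζ1 hwm' hw0' ŵ hŵm hdom' Cw hCw hΦm hΦ0 CΦ hΦle k
  have hBf : Integrable (fun U₀ : GaugeField (F.P K) k (SU N) => tkBranchOfRecord F N V ν M g K W' s S k Φ (baseCfg k U₀) * f U₀)
      (fieldMeasure (F.P K) k (SU N)) :=
    hB.mul_bdd hfm.aestronglyMeasurable (c := Cf) (Filter.Eventually.of_forall fun U₀ => by rw [Real.norm_eq_abs]; exact hfb U₀)
  -- on `f ≠ 0` the two branch operators agree at the base configuration (§1 with the ambient predicate `f((ω k).1) ≠ 0`)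
  have heq : (fun U₀ : GaugeField (F.P K) k (SU N) => f U₀ * tkBranchOfRecord F N V ν M g K W s S k Φ (baseCfg k U₀)) =
      fun U₀ => tkBranchOfRecord F N V ν M g K W' s S k Φ (baseCfg k U₀) * f U₀ := by
    funext U₀
    by_cases hf0 : f U₀ = 0
    · rw [hf0, zero_mul, mul_zero]
    · rw [mul_comm]
      congr 1
      refine (tkBranchOfRecord_congr_on_reading_locus ν M g K W W' s S k (baseCfg (V := V) k U₀)
        (fun ω => ∃ U : GaugeField (F.P K) k (SU N), f U ≠ 0 ∧ ∀ i, k ≤ i → ω i = baseCfg (V := V) k U i)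
        (fun ω ω' hag hω => ?_) (fun j _ => rfl) hζloc (fun j hj ω' hAω hlow hsupp => ?_) Φ (baseCfg k U₀) ⟨U₀, hf0, fun i _ => rfl⟩
        (fun i _ => rfl)).symm
      · obtain ⟨U, hU, hbase⟩ := hω
        exact ⟨U, hU, fun i hi => by rw [hag i hi]; exact hbase i hi⟩
      · rw [hw']
        refine Set.indicator_of_mem ?_ _
        refine hdom j hj ω' (fun i hi => ?_) hAω hsupp
        rw [hlow i hi]
        have hik : i ≠ k := Nat.ne_of_lt (lt_trans hi hj)
        exact Prod.ext (baseCfg_fst_of_ne (V := V) hik U₀) (baseCfg_snd (V := V) k i U₀)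
  rw [heq]
  exact hBf

end ReadingLocus

end Summit.QuantumFields.YangMills.Theorems.BalabanUVNodesN11TkBranchReadingLocus

end
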